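import Summits.ResolutionOfSingularities.ResolutionOfSingularities.Theorems.PurelyInseparableDim4ScopeBlindRational
import Summits.ResolutionOfSingularities.ResolutionOfSingularities.Theorems.PurelyInseparableDim4IsolatedScope
import HarnessLib

/-!
# Zoo certificate ‖ K — a SELF-REPRODUCING OUT-OF-SCOPE state under the point blow-up at `(p,q) = (3,3)`
# (cell `res-dim4-pi`, ZOO row of WORD #129 (c); brick (N2) «eng-w5 ZOO specimen ‖ K»)

[OURS · census certificate · counted 0 · AI kernel work, weaker than expert review.]  Census cell
«res-dim4-pi» (D-0157 DOOR 2), TY-4 series, seat res-dim4-p-4 g3.  res-dim4-eng-w5 g2 (bus 2026-08-29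
02:22:40Z, quick re-runs j322783 / j322817 / j322818) located from the `t1′` root after level 6 the `3`-fold
state over `𝔽₃`

  `F* = x₃·(x₁² + g²)`, `g = x₂ − x₄ + x₂x₄`, i.e.
  `F* = x₃x₄² + x₂x₃x₄ + x₂x₃x₄² + x₂²x₃ + 2x₂²x₃x₄ + x₂²x₃x₄² + x₁²x₃`,

and res-dim4-eng-w6 g2 replayed it (02:28:39Z, K = A exact + an elementary OUT certificate).  This file is
the kernel certificate of the ZOO row «(3,3) SELF-REPRODUCING OUT-OF-SCOPE STATE under the point blow-up»,
with `(x₁, x₂, x₃, x₄) = Fin 4`, over `ZMod 3`, in res-dim4-p-13's `StepKit` / `ScopeBlind` grammar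
(`decide`, no `native_decide`):

* §1 the state `s* = (F*, r = 0, exc = {x₂})` (`SelfRep33.s`), `F* = x₃(x₁² + g²)` letter for letter
  (`evalT_L`), `ord₀ F* = 3`, shade `3`;
* §2 **the point is the ONLY Hironaka-permissible coordinate centre** (`eq_univ_of_isPermissibleCentre`:
  `x₁²x₃`, `x₂²x₃`, `x₃x₄²` forbid every proper `S`), hence the MODE-1h centre, and it satisfies
  Hauser–Perlega's condition (2) (`perm2_univ`);
* §3 **self-reproduction LETTER FOR LETTER**: in the `x₂`-chart of the point blow-up, at the fibre point
  `b = (0,0,0,1)`, the translated transform is ALREADY `F*` (`pointTransform_eq`: no cube to delete), the point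
  is equimultiple, and `CentreBlowup.step 3 univ x₂ b s* = s*` (`step_eq`; the `F`-component for ANY
  bookkeeping `(r, exc)`: `step_F`).  So `s* → s*` is at once a `Step0`, `Step1h`, `StepHP`, `StepM1`, `Step2`
  edge and a `StepRule R` edge for EVERY permissible coordinate rule `R` (`stepRule_self`), `{s*}` is a
  one-state `IsTrap` at `(3,3)` (`isTrap_singleton`) — the `(3,3)` sibling of TRAP-1 (`…CoordinateTrap`,
  `p = 2`) and of the coordinate cage's 2-cycle (`…CoordinateCage`, every `p`);
* §4 **OUT of coordinate scope from move 0** (`not_inCoordinateScope`): `J₃⁺(F*) ≤ (x₁, x₃, g)` and the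
  regular NON-coordinate curve `C = V(x₁, x₃, g) = {(0, t/(1+t), 0, t)}` lies in the `3`-fold locus, while
  `D^{(e₃)}F* = x₁² + g²` is `1 ≠ 0` at `(0,0,0,1)` — res-dim4-p-13's rational-curve check `ScopeBlind.rblindB`
  by `decide`, soundness `ScopeBlind.not_inCoordinateScope_of_rblindB` (res-dim4-p-3's ring-map criterion);
  hence also NOT isolated (`not_isIsolated`, via `IsolatedScope.inCoordinateScope_of_isIsolated`);
* §5 the headline `exists_selfReproducing_blind_state_three` and the rule form
  `exists_constant_blind_branch_of_isPermissibleRule`: over `𝔽₃` at `q = 3` EVERY permissible coordinate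
  rule has the constant infinite branch `s* s* s* …`, blind at every step — TIER-2 material (blind from
  move 0), NOT an F4-C object (`TerminatesInScope 3 3` asks for in-scope branches) and NOT an F4-I object
  (`NoIsolatedTrap`: the state is not isolated); `¬ Terminates1h 3 3` / `¬ TerminatesSomeRule 3 3` were
  already tree facts (`…CoordinateCage`, `…LoopCMode1h`) and are not restated;
* §6 (appended, WORD #131 (g)) the `s1`-descendant of the same bus line, `F₂ = x₃(x₄² + x₂x₄ + x₂x₄² + x₁x₄ +
  x₁x₂ + x₁x₂x₄) = x₃·(x₁ + x₄)·(x₂ + x₄ + x₂x₄)`: point-only-permissible, a LITERAL 2-CYCLE under the point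
  blow-up (`x₂`-chart at `(1,0,0,2)` gives `F₂' = x₃(x₁ + x₄)(x₄ − x₂ + x₂x₄)`, `x₂`-chart at `(2,0,0,1)` gives
  `F₂` back; no cleaning at either move), `{s₁, s₁'}` an `IsTrap`, and BOTH states OUT of coordinate scope
  (curves `(−t, ∓t/(1±t), 0, t)` in `Sing₃`) — `exists_blind_two_cycle_three`.

Honest label: a statement about OUR coordinate-centre frame (`PIDim4.Step0/Step1h/StepHP/StepRule/IsTrap`,
`PIDim4.InCoordinateScope`) at ONE literal state; `𝔽₃`-rational reply; nothing here proves or refutes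
`TerminatesInScope 3 3`, `NoIsolatedTrap 3 3`, or resolution of singularities in dimension `≥ 4` /
characteristic `p`.  K = A ∧ w5 ∧ ‖ K.  bears_on: LADDER-RESOLUTION:D157-DOOR2 (res-dim4-pi · ZOO (3,3)
self-reproducing OUT state).  Supports stmt-ResolutionOfSingularities-16155 (helper).
-/

-- house layout `Summits/<Summit>/<Problem>` doubles the namespace component (as in the Target file)
set_option linter.dupNamespace false

noncomputable section

open MvPolynomial Finset

namespace Summit.ResolutionOfSingularities.ResolutionOfSingularities.Theorems.PIDim4

namespace ZooCert.SelfRep33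

open StepKit ScopeBlind
open Literature.AlgebraicGeometry.Resolution
open Literature.AlgebraicGeometry.Resolution.CentreBlowup
open Literature.AlgebraicGeometry.Resolution.Hauser2010

/-! ## §1 The state -/

/-- `F* = x₃x₄² + x₂x₃x₄ + x₂x₃x₄² + x₂²x₃ + 2x₂²x₃x₄ + x₂²x₃x₄² + x₁²x₃` over `𝔽₃` (eng-w5 g2's monomials,
to the letter). [folklore] -/
def L : Terms 4 (ZMod 3) :=
  [(![0, 0, 1, 2], 1), (![0, 1, 1, 1], 1), (![0, 1, 1, 2], 1), (![0, 2, 1, 0], 1), (![0, 2, 1, 1], 2),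
    (![0, 2, 1, 2], 1), (![2, 0, 1, 0], 1)]

/-- The presented state `s* = (F*, r = 0, exc = {x₂})`. [folklore] -/
def s : SData 4 (ZMod 3) := ⟨L, ![0, 0, 0, 0], {1}⟩

/-- The fibre point `b = (0,0,0,1)` (`x₄ = 1`) of the `x₂`-chart of the point blow-up. [folklore] -/
def b : Fin 4 → ZMod 3 := ![0, 0, 0, 1]

/-- `g = x₂ − x₄ + x₂x₄` as a term list. [folklore] -/
def Lg : Terms 4 (ZMod 3) := [(![0, 1, 0, 0], 1), (![0, 0, 0, 1], -1), (![0, 1, 0, 1], 1)]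

/-- `g = x₂ − x₄ + x₂x₄` is presented by `Lg`. [folklore] -/
theorem evalT_Lg : evalT Lg = (X 1 - X 3 + X 1 * X 3 : MvPolynomial (Fin 4) (ZMod 3)) := by
  simp [Lg, evalT, monomial_expo_eq, Fin.prod_univ_four]
  ring

/-- **`F* = x₃ · (x₁² + g²)` letter for letter** (`g = x₂ − x₄ + x₂x₄`). [folklore] -/
theorem evalT_L : evalT L = (X 2 * (X 0 ^ 2 + (X 1 - X 3 + X 1 * X 3) ^ 2) : MvPolynomial (Fin 4) (ZMod 3)) := by
  have hX2 : (X 2 : MvPolynomial (Fin 4) (ZMod 3)) = evalT [(![0, 0, 1, 0], (1 : ZMod 3))] := by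
    simp [evalT, monomial_expo_eq, Fin.prod_univ_four]
  have hX0 : (X 0 ^ 2 : MvPolynomial (Fin 4) (ZMod 3)) = evalT [(![2, 0, 0, 0], (1 : ZMod 3))] := by
    simp [evalT, monomial_expo_eq, Fin.prod_univ_four]
  rw [← evalT_Lg, hX2, hX0, sq, ← evalT_mulL, ← evalT_append, ← evalT_mulL]
  exact (evalT_eq_iff_equivB _ _).mpr (by decide)

/-- `s*.F = F*`. [folklore] -/
theorem toState_F : s.toState.F = evalT L := rfl

/-- `ord₀ F* = 3`. [folklore] -/
theorem ordZero_F : ordZero s.toState.F = 3 := by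
  rw [SData.toState_F, ordZero_evalT]; decide

/-- `ord_{(x₁,…,x₄)} F* = 3`: the origin is a `3`-fold point of `z³ + F*`. [folklore] -/
theorem ordAlong_univ_F : ordAlong Finset.univ s.toState.F = 3 := by
  rw [SData.toState_F, ordAlong_evalT]; decide

/-- The shade of `s*` is `3` (`r = 0`). [folklore] -/
theorem shade_s : s.toState.shade = 3 := by rw [shade_toState]; decide

/-- `F* ≠ 0`. [folklore] -/
theorem F_ne_zero : s.toState.F ≠ 0 := by
  rw [SData.toState_F, Ne, evalT_eq_zero_iff]; decide

/-! ## §2 The point is the only permissible coordinate centre -/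

/-- **Only the point is Hironaka-permissible**: `V(z, x_S)` with `F* ∈ (x_S)³` forces `S = {x₁,…,x₄}`
(`x₁²x₃ ⇒ x₁, x₃ ∈ S`; `x₂²x₃ ⇒ x₂ ∈ S`; `x₃x₄² ⇒ x₄ ∈ S`). [folklore] -/
theorem eq_univ_of_isPermissibleCentre {S : Finset (Fin 4)} (hS : IsPermissibleCentre 3 S s.toState.F) :
    S = Finset.univ := by
  rw [SData.toState_F, isPermissibleCentre_iff] at hS
  revert S
  decide

/-- The point `V(z, x₁, …, x₄)` is Hironaka-permissible. [folklore] -/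
theorem isPermissibleCentre_univ : IsPermissibleCentre 3 Finset.univ s.toState.F := by
  rw [SData.toState_F, isPermissibleCentre_iff]; decide

/-- Hence the point is the MODE-1h centre of `s*`. [folklore] -/
theorem isMode1hCentre_univ : IsMode1hCentre 3 Finset.univ s.toState.F := by
  rw [SData.toState_F, isMode1hCentre_iff]; decide

/-- … the only one. [folklore] -/
theorem isMode1hCentre_iff (S : Finset (Fin 4)) : IsMode1hCentre 3 S s.toState.F ↔ S = Finset.univ :=
  ⟨fun h => eq_univ_of_isPermissibleCentre h.1, fun h => h ▸ isMode1hCentre_univ⟩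

/-- The point satisfies Hauser–Perlega's condition (2) at `s*` (`0 + 3 ≤ 3`). [folklore] -/
theorem perm2_univ : Perm2 Finset.univ s.toState := (perm2_iff _ s).mpr (by decide)

/-! ## §3 Self-reproduction, letter for letter -/

/-- **No cleaning needed**: the translated transform in the `x₂`-chart at `b = (0,0,0,1)` is ALREADY `F*`
(`x₂`-chart: `x₃(x₁² + (1 − x₄ + x₂x₄)²)`; `x₄ ↦ x₄ + 1` sends `1 − x₄ + x₂x₄` to `g`). [folklore] -/
theorem pointTransform_eq : pointTransform 3 Finset.univ 1 b s.toState = s.toState.F := by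
  rw [pointTransform_toState, SData.toState_F]
  exact (evalT_eq_iff_equivB _ _).mpr (by decide)

/-- `b = (0,0,0,1)` is an equimultiple point of the `x₂`-chart. [folklore] -/
theorem isEquimultiplePoint_b : IsEquimultiplePoint 3 Finset.univ 1 b s.toState :=
  (isEquimultiplePoint_iff 3 Finset.univ 1 b s).mpr (by decide)

/-- **Self-reproduction**: `step 3 univ x₂ (0,0,0,1) s* = s*` — `F`, `r = 0` and `exc = {x₂}` all return.
[folklore] -/
theorem step_eq : CentreBlowup.step 3 Finset.univ 1 b s.toState = s.toState :=
  (step_eq_iff 3 Finset.univ 1 b s s).mpr (by decide)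

/-- The `F`-component returns for ANY bookkeeping `(r, exc)` (the chart transform, translation and
cleaning do not read `r`, `exc`). [folklore] -/
theorem step_F (r : Fin 4 → ℕ) (exc : Finset (Fin 4)) :
    (CentreBlowup.step 3 Finset.univ 1 b (⟨L, r, exc⟩ : SData 4 (ZMod 3)).toState).F = evalT L := by
  rw [step_toState, SData.toState_F]
  show evalT (cleanL 3 (transAll b (chartL 3 Finset.univ 1 L))) = evalT L
  exact (evalT_eq_iff_equivB _ _).mpr (by decide)

/-- The loop edge `s* → s*` along the point. [folklore] -/
theorem edge_self : Edge 3 Finset.univ s.toState s.toState :=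
  edge_of 1 b (Finset.mem_univ _) (by decide) (by decide) (by decide) (by decide)

/-- It is a MODE-0 (point) step. [folklore] -/
theorem step0_self : Step0 3 s.toState s.toState :=
  step0_of 1 b (by decide) (by decide) (by decide) (by decide) (by decide)

/-- It is a MODE-1h step (the point is the largest — indeed the only — permissible coordinate centre). [folklore] -/
theorem step1h_self : Step1h 3 s.toState s.toState :=
  step1h_of Finset.univ 1 b (by decide) (Finset.mem_univ _) (by decide) (by decide) (by decide) (by decide)

/-- It is an HP-permissible ((1) ∧ (2)) step. [folklore] -/
theorem stepHP_self : StepHP 3 s.toState s.toState :=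
  stepHP_of Finset.univ 1 b (by decide) (by decide) (Finset.mem_univ _) (by decide) (by decide) (by decide)
    (by decide)

/-- It is an `m1` step. [folklore] -/
theorem stepM1_self : StepM1 3 s.toState s.toState :=
  stepM1_of Finset.univ 1 b (by decide) (Finset.mem_univ _) (by decide) (by decide) (by decide) (by decide)

/-- It is a MODE-2 step. [folklore] -/
theorem step2_self : Step2 3 s.toState s.toState :=
  step2_of Finset.univ 1 b (by decide) (Finset.mem_univ _) (by decide) (by decide) (by decide) (by decide)

/-- **Every permissible coordinate rule loops at `s*`**: the rule must pick the point. [folklore] -/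
theorem stepRule_self (R : CentreRule (ZMod 3)) (hR : IsPermissibleRule 3 R) :
    StepRule 3 R s.toState s.toState := by
  have hperm : IsPermissibleCentre 3 (R s.toState) s.toState.F := hR _ ⟨Finset.univ, isPermissibleCentre_univ⟩
  have huniv : R s.toState = Finset.univ := eq_univ_of_isPermissibleCentre hperm
  refine ⟨hperm, ?_⟩
  rw [huniv]
  exact edge_self

/-- **`{s*}` is a one-state TRAP at `(3,3)`** (the `p = 3` sibling of TRAP-1). [folklore] -/
theorem isTrap_singleton : IsTrap 3 ({s.toState} : Set (State (ZMod 3))) := by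
  intro x hx
  rw [Set.mem_singleton_iff] at hx
  subst hx
  refine ⟨le_of_eq ordAlong_univ_F.symm, fun S hS => ⟨s.toState, rfl, ?_⟩⟩
  rw [eq_univ_of_isPermissibleCentre hS]
  exact edge_self

/-! ## §4 Out of coordinate scope from move 0 -/

/-- The denominator `1 + t` of the curve `x₂ = t/(1+t)`. [folklore] -/
def onePlusT : Terms 1 (ZMod 3) := [(![0], 1), (![1], 1)]

/-- **Rational blindness certificate**: the curve `(x₁, x₂, x₃, x₄) = (0, t/(1+t), 0, t)` passes through
the origin, kills every `D^{(α)}F*` with `0 < |α| < 3` (all lie in `(x₁, x₃, g)`), its `x₂`, `x₄`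
coordinates are non-zero, and `D^{(e₃)}F* = x₁² + g²` is `1 ≠ 0` at `(0,0,0,1)`. [folklore] -/
theorem rblindB_s : rblindB 3 s (monoP ![0, 1, 0, 1] ![0, 1, 0, 1]) ![0, 1, 0, 0] onePlusT ![0, 1, 0, 1]
    ![0, 0, 1, 0] ![0, 0, 0, 1] = true := by
  decide

/-- **`F*` is OUT of coordinate scope**: the regular non-coordinate curve `V(x₁, x₃, x₂ − x₄ + x₂x₄)`
through the origin lies in the `3`-fold locus of `z³ + F*`. [folklore] -/
theorem not_inCoordinateScope : ¬ InCoordinateScope 3 s.toState.F :=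
  not_inCoordinateScope_of_rblindB rblindB_s

/-- Hence `F*` is NOT an isolated `3`-fold point either (not an F4-I object). [folklore] -/
theorem not_isIsolated : ¬ IsIsolated 3 s.toState.F :=
  fun h => not_inCoordinateScope (IsolatedScope.inCoordinateScope_of_isIsolated h)

end ZooCert.SelfRep33

/-! ## §5 Headlines -/

open ZooCert.SelfRep33 in
/-- **ZOO (3,3) ‖ K — a self-reproducing out-of-scope state under the point blow-up.**  Over `𝔽₃` at
`q = 3` the state `s* = (x₃(x₁² + (x₂ − x₄ + x₂x₄)²), 0, {x₂})` is a fixed point of the point-blow-up step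
(chart `x₂`, fibre point `(0,0,0,1)`), the point being its only permissible coordinate centre — so the
loop is a `Step0`, `Step1h` and `StepHP` edge at once — and it is OUT of coordinate scope and NOT isolated.
Census value only (TIER-2: blind from move 0; not an F4-C / F4-I object). [folklore] -/
theorem exists_selfReproducing_blind_state_three :
    ∃ s : State (ZMod 3), Step0 3 s s ∧ Step1h 3 s s ∧ StepHP 3 s s ∧
      (∀ S, IsPermissibleCentre 3 S s.F → S = Finset.univ) ∧ ¬ InCoordinateScope 3 s.F ∧ ¬ IsIsolated 3 s.F :=
  ⟨s.toState, step0_self, step1h_self, stepHP_self, fun _ h => eq_univ_of_isPermissibleCentre h,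
    not_inCoordinateScope, not_isIsolated⟩

open ZooCert.SelfRep33 in
/-- **Rule form.**  Over `𝔽₃` at `q = 3`, EVERY Hironaka-permissible coordinate-centre rule has an infinite
branch all of whose states are OUT of coordinate scope — the constant branch at `s*`.  (So this witness
says nothing about `TerminatesInScope 3 3`, whose branches are required IN scope; `¬ TerminatesSomeRule 3 3`
itself is the tree's `CoordinateCage.not_terminatesSomeRule_of_prime`.) [folklore] -/
theorem exists_constant_blind_branch_of_isPermissibleRule (R : CentreRule (ZMod 3))
    (hR : IsPermissibleRule 3 R) :
    ∃ c : ℕ → State (ZMod 3), (∀ k, StepRule 3 R (c k) (c (k + 1))) ∧ ∀ k, ¬ InCoordinateScope 3 (c k).F :=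
  ⟨fun _ => s.toState, fun _ => stepRule_self R hR, fun _ => not_inCoordinateScope⟩

/-! ## §6 The `s1`-descendant: a blind 2-cycle, letter for letter (WORD #131 (g)) -/

namespace ZooCert.SelfRep33

open StepKit ScopeBlind
open Literature.AlgebraicGeometry.Resolution
open Literature.AlgebraicGeometry.Resolution.CentreBlowup
open Literature.AlgebraicGeometry.Resolution.Hauser2010

/-- `F₂ = x₃x₄² + x₂x₃x₄ + x₂x₃x₄² + x₁x₃x₄ + x₁x₂x₃ + x₁x₂x₃x₄` over `𝔽₃` (eng-w5 g2's `s1`-descendant after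
level 5, bus 2026-08-29 02:22:40Z, monomials to the letter). [folklore] -/
def L1 : Terms 4 (ZMod 3) :=
  [(![0, 0, 1, 2], 1), (![0, 1, 1, 1], 1), (![0, 1, 1, 2], 1), (![1, 0, 1, 1], 1), (![1, 1, 1, 0], 1),
    (![1, 1, 1, 1], 1)]

/-- Its partner `F₂' = x₃x₄² − x₂x₃x₄ + x₂x₃x₄² + x₁x₃x₄ − x₁x₂x₃ + x₁x₂x₃x₄` (`x₂ ↦ −x₂` in `F₂`). [folklore] -/
def L1' : Terms 4 (ZMod 3) :=
  [(![0, 0, 1, 2], 1), (![0, 1, 1, 1], -1), (![0, 1, 1, 2], 1), (![1, 0, 1, 1], 1), (![1, 1, 1, 0], -1),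
    (![1, 1, 1, 1], 1)]

/-- The state `s₁ = (F₂, 0, {x₂})`. [folklore] -/
def s1 : SData 4 (ZMod 3) := ⟨L1, ![0, 0, 0, 0], {1}⟩
/-- The state `s₁' = (F₂', 0, {x₂})`. [folklore] -/
def s1' : SData 4 (ZMod 3) := ⟨L1', ![0, 0, 0, 0], {1}⟩

/-- First move: `x₂`-chart, fibre point `(1,0,0,2)` (`x₁ = 1`, `x₄ = −1`). [folklore] -/
def b1 : Fin 4 → ZMod 3 := ![1, 0, 0, 2]
/-- Second move: `x₂`-chart, fibre point `(2,0,0,1)` (`x₁ = −1`, `x₄ = 1`). [folklore] -/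
def b1' : Fin 4 → ZMod 3 := ![2, 0, 0, 1]

/-- **`F₂ = x₃ · (x₁ + x₄) · (x₂ + x₄ + x₂x₄)`** — three regular factors through the origin. [folklore] -/
theorem evalT_L1 :
    evalT L1 = (X 2 * (X 0 + X 3) * (X 1 + X 3 + X 1 * X 3) : MvPolynomial (Fin 4) (ZMod 3)) := by
  simp [L1, evalT, monomial_expo_eq, Fin.prod_univ_four]
  ring

/-- **`F₂' = x₃ · (x₁ + x₄) · (x₄ − x₂ + x₂x₄)`.** [folklore] -/
theorem evalT_L1' :
    evalT L1' = (X 2 * (X 0 + X 3) * (X 3 - X 1 + X 1 * X 3) : MvPolynomial (Fin 4) (ZMod 3)) := by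
  simp [L1', evalT, monomial_expo_eq, Fin.prod_univ_four]
  ring

/-- Only the point is Hironaka-permissible at `s₁` (`x₁x₂x₃`, `x₁x₃x₄`, `x₂x₃x₄`, `x₃x₄²` forbid every proper `S`).
[folklore] -/
theorem s1_eq_univ_of_isPermissibleCentre {S : Finset (Fin 4)} (hS : IsPermissibleCentre 3 S s1.toState.F) :
    S = Finset.univ := by
  rw [SData.toState_F, isPermissibleCentre_iff] at hS
  revert S
  decide

/-- Only the point is Hironaka-permissible at `s₁'`. [folklore] -/
theorem s1'_eq_univ_of_isPermissibleCentre {S : Finset (Fin 4)} (hS : IsPermissibleCentre 3 S s1'.toState.F) :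
    S = Finset.univ := by
  rw [SData.toState_F, isPermissibleCentre_iff] at hS
  revert S
  decide

/-- **First move, letter for letter**: `step 3 univ x₂ (1,0,0,2) s₁ = s₁'` (no cube to delete: the translated
transform is already `F₂'`). [folklore] -/
theorem step_s1 : CentreBlowup.step 3 Finset.univ 1 b1 s1.toState = s1'.toState :=
  (step_eq_iff 3 Finset.univ 1 b1 s1 s1').mpr (by decide)

/-- **Second move, letter for letter**: `step 3 univ x₂ (2,0,0,1) s₁' = s₁` (again nothing to clean). [folklore] -/
theorem step_s1' : CentreBlowup.step 3 Finset.univ 1 b1' s1'.toState = s1.toState :=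
  (step_eq_iff 3 Finset.univ 1 b1' s1' s1).mpr (by decide)

/-- `s₁ ≠ s₁'` (a genuine 2-cycle, not a fixed point). [folklore] -/
theorem s1_ne_s1' : s1.toState ≠ s1'.toState := toState_ne_of s1 s1' (by decide)

/-- `s₁ → s₁'` is a MODE-0, MODE-1h and HP ((1) ∧ (2)) step. [folklore] -/
theorem steps_s1 : Step0 3 s1.toState s1'.toState ∧ Step1h 3 s1.toState s1'.toState ∧ StepHP 3 s1.toState s1'.toState :=
  ⟨step0_of 1 b1 (by decide) (by decide) (by decide) (by decide) (by decide),
    step1h_of Finset.univ 1 b1 (by decide) (Finset.mem_univ _) (by decide) (by decide) (by decide) (by decide),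
    stepHP_of Finset.univ 1 b1 (by decide) (by decide) (Finset.mem_univ _) (by decide) (by decide) (by decide)
      (by decide)⟩

/-- `s₁' → s₁` is a MODE-0, MODE-1h and HP ((1) ∧ (2)) step. [folklore] -/
theorem steps_s1' :
    Step0 3 s1'.toState s1.toState ∧ Step1h 3 s1'.toState s1.toState ∧ StepHP 3 s1'.toState s1.toState :=
  ⟨step0_of 1 b1' (by decide) (by decide) (by decide) (by decide) (by decide),
    step1h_of Finset.univ 1 b1' (by decide) (Finset.mem_univ _) (by decide) (by decide) (by decide) (by decide),
    stepHP_of Finset.univ 1 b1' (by decide) (by decide) (Finset.mem_univ _) (by decide) (by decide) (by decide)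
      (by decide)⟩

/-- **`{s₁, s₁'}` is a TRAP at `(3,3)`**: every permissible centre is the point, answered inside the pair
(`q`-fold origin and the edges read off `Step0`). [folklore] -/
theorem isTrap_pair : IsTrap 3 ({s1.toState, s1'.toState} : Set (State (ZMod 3))) := by
  intro x hx
  rcases hx with rfl | hx
  · refine ⟨steps_s1.1.1, fun S hS => ⟨s1'.toState, Or.inr rfl, ?_⟩⟩
    rw [s1_eq_univ_of_isPermissibleCentre hS]
    exact steps_s1.1.2
  · rw [Set.mem_singleton_iff] at hx
    subst hx
    refine ⟨steps_s1'.1.1, fun S hS => ⟨s1.toState, Or.inl rfl, ?_⟩⟩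
    rw [s1'_eq_univ_of_isPermissibleCentre hS]
    exact steps_s1'.1.2

/-- The denominator `1 − t` of the curve `x₂ = t/(1−t)` at `s₁'`. [folklore] -/
def oneMinusT : Terms 1 (ZMod 3) := [(![0], 1), (![1], -1)]

/-- Blindness certificate at `s₁`: the curve `(−t, −t/(1+t), 0, t) ⊂ V(x₃, x₁ + x₄, x₂ + x₄ + x₂x₄)` kills
`J₃⁺(F₂)`; witness `D^{(e₃)}F₂ (1,1,0,0) = 1`. [folklore] -/
theorem rblindB_s1 : rblindB 3 s1 (monoP ![-1, -1, 0, 1] ![1, 1, 0, 1]) ![0, 1, 0, 0] onePlusT ![1, 1, 0, 1]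
    ![0, 0, 1, 0] ![1, 1, 0, 0] = true := by
  decide

/-- Blindness certificate at `s₁'`: the curve `(−t, t/(1−t), 0, t) ⊂ V(x₃, x₁ + x₄, x₄ − x₂ + x₂x₄)` kills
`J₃⁺(F₂')`; witness `D^{(e₃)}F₂' (1,1,0,0) = −1`. [folklore] -/
theorem rblindB_s1' : rblindB 3 s1' (monoP ![-1, 1, 0, 1] ![1, 1, 0, 1]) ![0, 1, 0, 0] oneMinusT ![1, 1, 0, 1]
    ![0, 0, 1, 0] ![1, 1, 0, 0] = true := by
  decide

/-- **`F₂` is OUT of coordinate scope.** [folklore] -/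
theorem not_inCoordinateScope_s1 : ¬ InCoordinateScope 3 s1.toState.F := not_inCoordinateScope_of_rblindB rblindB_s1
/-- **`F₂'` is OUT of coordinate scope.** [folklore] -/
theorem not_inCoordinateScope_s1' : ¬ InCoordinateScope 3 s1'.toState.F := not_inCoordinateScope_of_rblindB rblindB_s1'

end ZooCert.SelfRep33

open ZooCert.SelfRep33 in
/-- **ZOO (3,3) ‖ K, second specimen — a blind 2-cycle under the point blow-up.**  Over `𝔽₃` at `q = 3` the
states `(x₃(x₁ + x₄)(x₂ + x₄ + x₂x₄), 0, {x₂})` and `(x₃(x₁ + x₄)(x₄ − x₂ + x₂x₄), 0, {x₂})` form a literal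
2-cycle of the point-blow-up step (both moves in the `x₂`-chart, fibre points `(1,0,0,2)` and `(2,0,0,1)`),
each point-only-permissible (so the edges are `Step0`, `Step1h`, `StepHP` at once), the pair is a trap, and
BOTH states are OUT of coordinate scope.  Census value only (TIER-2; not an F4-C object). [folklore] -/
theorem exists_blind_two_cycle_three :
    ∃ s s' : State (ZMod 3), s ≠ s' ∧ Step0 3 s s' ∧ Step0 3 s' s ∧ Step1h 3 s s' ∧ Step1h 3 s' s ∧
      IsTrap 3 ({s, s'} : Set (State (ZMod 3))) ∧ ¬ InCoordinateScope 3 s.F ∧ ¬ InCoordinateScope 3 s'.F :=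
  ⟨s1.toState, s1'.toState, s1_ne_s1', steps_s1.1, steps_s1'.1, steps_s1.2.1, steps_s1'.2.1, isTrap_pair,
    not_inCoordinateScope_s1, not_inCoordinateScope_s1'⟩

end Summit.ResolutionOfSingularities.ResolutionOfSingularities.Theorems.PIDim4

end
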